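import Summits.BirchSwinnertonDyer.BirchSwinnertonDyer.Theorems.GenusKolyvaginAtTwoMinimalTwinBSDTwoIdentityDoorTwinExistence
import Summits.BirchSwinnertonDyer.BirchSwinnertonDyer.Theorems.GenusKolyvaginAtTwoMinimalTwinBSDTwoEggAllImages
import Summits.BirchSwinnertonDyer.BirchSwinnertonDyer.Theorems.GenusKolyvaginAtTwoMinimalTwinBSDTwoDoorOpenPrimes
import HarnessLib

/-!
# Route `GenusKolyvaginAtTwo`, crux U₂ `MinimalTwinBSDTwo` (stmt-BirchSwinnertonDyer-22985), LINE 23 «twin_swap»: THE TWIN EXISTS —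
# every globally minimal `W/ℚ` of rank `1` with `#Sel₂(W) = 2` has a `2`-SELMER-TRIVIAL globally minimal twin by a PRIME HEEGNER discriminant (UNCONDITIONAL)

Seat `bsd-line-gk2-p2` g26 (PROVER seat 2/3, cell `bsd-f1-sign2`, LINE 23 holder), `--supports stmt-BirchSwinnertonDyer-22985` (helper; closes nothing).
ONE THEOREM; standard axioms; **UNCONDITIONAL**.  **BSD is NOT proved by this file; U₂ is NOT proved; nothing is closed.**

The three twin supplies of LINE 23, each unconditional given rank `1`, glued along the exhaustive trichotomy of skeleton v2.1:
* `Δ < 0` — gk2-p4/this lineage's DOOR-OPEN primes (`DoorOpen.exists_doorOpen_prime_heegnerField_selmerTrivialTwin`; `ρ̄₂` onto is automatic there: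
  `DoorOpen.hasSurjectiveModNGaloisRep_two_of_negDisc_of_natCard_selmerGroup_eq_two`);
* `Δ > 0`, `MeetsEgg` — gk2-p3's SILENT primes (`EggAllImages.exists_silentPrime_heegnerField_selmerTrivialTwin_of_meetsEgg`);
* `Δ > 0`, `¬MeetsEgg` — this seat's IDENTITY primes (`IdentityDoor.exists_identityDoor_selmerTrivial_minimalTwin_of_rank_one`, part 6).
Result `exists_primeHeegner_selmerTrivial_minimalTwin_of_rank_one`: for EVERY globally minimal elliptic `W/ℚ` with `rank W(ℚ) = 1` and `#Sel₂(W) = 2` there are a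
prime `ℓ`, the imaginary quadratic field `K` with `d_K = −ℓ` (odd, `≠ −3`, Heegner for `N_W`, `2` split) and a globally minimal `Wd ≅ W^{(−ℓ)}` with `#Sel₂(Wd) = 1`.
This is the object LINE 23 swaps `W` for; on U₂ (`r_an = 1`) rank `1` is the print item GZK.  (Mazur–Rubin [Thm. 1.5] give `2`-Selmer-trivial twists in general;
the point here is the Heegner side conditions and the prime discriminant, which the Kolyvagin descent over `K` needs.)

References: [MazurRubin2010] Thm. 1.5, Prop. 3.3, Lemma 3.5–3.6; [Kramer1981] Thm. 1; [GrossLMS1991] §1; [SilvermanAEC2009] VIII.8, X.4.2.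
-/

set_option linter.dupNamespace false -- tree convention: `Summit.BirchSwinnertonDyer.BirchSwinnertonDyer.Theorems` (summit = sub-problem)
set_option autoImplicit false

noncomputable section

open scoped Classical

namespace Summit.BirchSwinnertonDyer.BirchSwinnertonDyer.Theorems.GenusExact.TwinSwap.IdentityDoor

open WeierstrassCurve NumberField
open Literature.NumberTheory.GaloisRepresentations Literature.NumberTheory.EllipticCurves
open Summit.BirchSwinnertonDyer.Rank1Residual.F1Sign2 (MeetsEgg)
open Summit.BirchSwinnertonDyer.BirchSwinnertonDyer.Theorems.GenusExact.TwinSwap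

/-- **THE TWIN EXISTS (UNCONDITIONAL).**  For every globally minimal elliptic curve `W/ℚ` with `rank W(ℚ) = 1` and `#Sel₂(W) = 2` there exist a prime `ℓ`, a number
field `K` with `d_K = −ℓ` — imaginary quadratic, `d_K` odd and `≠ −3`, satisfying the Heegner hypothesis for `N_W`, with `2` split — and a GLOBALLY MINIMAL
Weierstrass model `Wd` of the quadratic twist `W^{(d_K)}` whose `2`-Selmer group is TRIVIAL: `#Sel₂(Wd) = 1`.  Proof: trichotomy `Δ < 0` (door-open twisting
prime: `ρ̄₂` is onto since `Δ < 0` and `E(ℚ)[2] = 0`), `Δ > 0 ∧ MeetsEgg` (silent prime), `Δ > 0 ∧ ¬MeetsEgg` (identity prime) — three Čebotarev supplies with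
Poitou–Tate/Kramer counts, all tree theorems.  [cite: MazurRubin2010, Thm. 1.5, Prop. 3.3, Lemma 3.5–3.6] [cite: Kramer1981, Thm. 1] [cite: GrossLMS1991, §1 (p. 235)]
[cite: SilvermanAEC2009, VIII.8 Cor. 8.3, X.4.2] -/
theorem exists_primeHeegner_selmerTrivial_minimalTwin_of_rank_one (W : WeierstrassCurve ℚ) [W.IsElliptic] [W.IsGloballyMinimal]
    (hrk : W.mordellWeilRank = 1) (hSel : Nat.card (W.selmerGroup 2) = 2) :
    ∃ (K : Type) (_ : Field K) (_ : NumberField K) (ℓ : ℕ), ℓ.Prime ∧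
      IsImaginaryQuadratic K ∧ NumberField.discr K = -(ℓ : ℤ) ∧ Odd (NumberField.discr K) ∧ NumberField.discr K ≠ -3 ∧
      SatisfiesHeegnerHypothesis (W.conductorNorm ℤ) K ∧ ((Ideal.span {(2 : ℤ)}).primesOver (𝓞 K)).ncard = 2 ∧
      ∃ (Wd : WeierstrassCurve ℚ) (_ : Wd.IsElliptic) (_ : Wd.IsGloballyMinimal),
        (∃ C : VariableChange ℚ, C • W.quadraticTwist (NumberField.discr K : ℚ) = Wd) ∧ Nat.card (Wd.selmerGroup 2) = 1 := by
  -- an elliptic curve has `Δ ≠ 0`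
  have hΔ0 : W.Δ ≠ 0 := by rw [← WeierstrassCurve.coe_Δ']; exact W.Δ'.ne_zero
  rcases lt_or_gt_of_ne hΔ0 with hneg | hpos
  · -- `Δ < 0`: a door-open twisting prime (`ρ̄₂` onto is automatic)
    have hsurj := DoorOpen.hasSurjectiveModNGaloisRep_two_of_negDisc_of_natCard_selmerGroup_eq_two W hneg hSel hrk
    obtain ⟨ℓ, hℓF, -, -, -, -, K, _, _, hK, hd, hodd, hd3, hH, h2K, -, -, Wd, _, _, hWd, hSel1, -⟩ :=
      DoorOpen.exists_doorOpen_prime_heegnerField_selmerTrivialTwin W hneg hsurj hSel 0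
    exact ⟨K, inferInstance, inferInstance, ℓ, hℓF.out, hK, hd, hodd, hd3, hH, h2K, Wd, inferInstance, inferInstance, hWd, hSel1⟩
  · by_cases hegg : MeetsEgg W
    · -- the egg: a silent prime
      obtain ⟨K, _, _, ℓ, hℓ, hK, hd, -, hodd, hd3, hH, -, h2K, Wd, _, _, Cd, hCd, hSel1⟩ :=
        EggAllImages.exists_silentPrime_heegnerField_selmerTrivialTwin_of_meetsEgg W hpos hrk hSel hegg
      exact ⟨K, inferInstance, inferInstance, ℓ, hℓ, hK, hd, hodd, hd3, hH, h2K, Wd, inferInstance, inferInstance, ⟨Cd, hCd⟩, hSel1⟩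
    · -- off the egg: an identity prime
      obtain ⟨K, _, _, ℓ, hℓF, hK, hd, -, -, hodd, hd3, hH, h2K, Wd, _, _, hWd, hSel1⟩ :=
        exists_identityDoor_selmerTrivial_minimalTwin_of_rank_one W hrk hSel hpos hegg
      exact ⟨K, inferInstance, inferInstance, ℓ, hℓF.out, hK, hd, hodd, hd3, hH, h2K, Wd, inferInstance, inferInstance, hWd, hSel1⟩

end Summit.BirchSwinnertonDyer.BirchSwinnertonDyer.Theorems.GenusExact.TwinSwap.IdentityDoor

end
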